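import Summits.BirchSwinnertonDyer.BirchSwinnertonDyer.Theses.UniversalToricDescent
import Literature.NumberTheory.EllipticCurves.AnticyclotomicPrimeDecompositionSplitProofs
import HarnessLib

/-!
# Route `UniversalToricDescent` — support leaf `BrinkSplitPrimesFinitelyDecomposedFact`
# (stmt-BirchSwinnertonDyer-20465): a tree THEOREM, by name

Seat `bsd-wall-utd-p1`, gen 5 (cell `bsd-wall`, lane 3 UTD). Leaf 5/7 of crux #5
`WildSplitControlAtThree`'s published-fact split: Brink 2007 Thm 2 — a prime of the imaginary
quadratic `K` away from `p` whose rational prime splits in `K` is finitely decomposed in the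
anticyclotomic `ℤ_p`-extension — is the tree theorem
`Literature.NumberTheory.EllipticCurves.ZpExtension.decomp_not_le_kerSubgroup_of_isAnticyclotomic_holds`
(module `Literature/NumberTheory/EllipticCurves/AnticyclotomicPrimeDecompositionSplitProofs`;
candidate `exact …_holds` recorded by refuter-parity-tllh-ref-1 g1, evidence 15:15Z).
HONEST FRAMING: one token; BSD is not advanced by this.

References: [Brink2007] Thm. 2 (pp. 2134–2135) and §II Prop. 1 (p. 2130).
-/

set_option linter.dupNamespace false

namespace Summit.BirchSwinnertonDyer.BirchSwinnertonDyer.Theorems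

open Summit.BirchSwinnertonDyer.BirchSwinnertonDyer.Theses.UniversalToricDescent

/-- **Leaf `BrinkSplitPrimesFinitelyDecomposedFact` (item 20465) holds**: for every number field
`K` and prime `p`, the named fact `decomp_not_le_kerSubgroup_of_isAnticyclotomic K p` (Brink 2007
Thm 2: `K` imaginary quadratic, `p` odd, `κ` anticyclotomic, `v ∤ p` of degree one ⇒ `D_v ⊄ ker κ`)
— the tree theorem `decomp_not_le_kerSubgroup_of_isAnticyclotomic_holds`.
[cite: Brink2007, Thm. 2 (pp. 2134–2135, last assertion); §II Prop. 1 (p. 2130)] -/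
theorem brinkSplitPrimesFinitelyDecomposedFact_proof : BrinkSplitPrimesFinitelyDecomposedFact := by
  unfold BrinkSplitPrimesFinitelyDecomposedFact
  intro K _ _ p _
  exact Literature.NumberTheory.EllipticCurves.ZpExtension.decomp_not_le_kerSubgroup_of_isAnticyclotomic_holds
    K p

end Summit.BirchSwinnertonDyer.BirchSwinnertonDyer.Theorems
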